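import Summits.QuantumFields.YangMills.Theorems.UnitScaleTiltProp7MassivePropagatorAgmon
import Summits.QuantumFields.YangMills.Theorems.UnitScaleTiltProp7CovLapSiteEntryRows
import HarnessLib

/-!
# Route `UnitScaleTilt`, crux K1 «MinimiserStabilityRegPr» (stmt-QuantumFields-19200), EX row `hGF[Lift]` ∕ `h349[Lift]` (curved member) — **LOD LINE BRICK (L5′-member), FILE B2a
# (routeR-w2 g12, LOCATE-L5-GRAMSHELLS 7416633c road (G)): THE CONJUGATED MASSIVE PROPAGATOR IS CLOSE TO THE PROPAGATOR — `‖e^{φ}·G_a(e^{−φ}·w) − G_a w‖ ≤ δ·‖w‖` with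
# `δ = O(C_P⁴·(η⁻¹(e^{θ}−1) + √a·C_T(e^{θ′}−1)))` K-uniformly — the `hplus`∕`hminus` input of ✓`Prop7GramConjAccretive.re_conj_gram_ge` at the T³ member, from px5's (A-L²)+(A-H¹)
# rows and the FORM-sense commutator `[A, e^{φ}]` (the operator-norm commutator is NOT small for Lipschitz weights: it carries `η⁻²(e^{θ}−1)`-size kink terms; only the form is).**

Cell `ym3-torus` (HUMAN RULING D-0037, YM ladder rung R3 — NOT d = 4, NOT infinite volume, NOT a mass gap, NOT Clay).  Width seat `ym-routeR-w2` gen 12 (D-0154 (3c); chair ★p1 g24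
22:38:36Z «road (L5′-G) adopted», 23:28:16Z «GO»; ★★OWNER RULINGS №33∕№35).  THEOREMS ONLY (0 `def`, 0 `sorry`); px5 g11's member letters VERBATIM (✓`Prop7MassivePropagatorAgmonLetters`,
✓`…Coercive`, ✓`…Agmon`: `Q''`∕`hseq`, `ι`∕`hι`, `T`∕`hT`, the massive inverse `G` with `hAG`∕`hGA` = ✓`exists_massive_inverse`), px17 ✓`Prop7CovLapSiteEntryRows.inner_covLapSite_eq_inner_DL2`;
`--supports stmt-QuantumFields-19200 --as helper`, count-neutral.  HONEST LABEL (№33 (6)): curved γ-row ∕ (3.49) supplier line (LOD localisation), the coarse-Gram Agmon step (G);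
nothing of (3.49), Thm 3.1∕3.3, `h349`, `hGF`, (L5″), EX ∕ 19200 is proved here; no summit statement is proved by this seat.  K-UNIFORMITY PIN (★p1 g24 22:52Z ∕ 23:54:10Z, px16 g11's question): `C_P² = max 2 (16c₀(L^{K−n})³∕(a c₁))` is
K-free AT THE PINNED WEIGHTS `c₁ = c₀·L^{3(K−n)}` (then `C_P² = max 2 (16∕a)`) with `a` the FIXED mass parameter of the massive operator; every `δ`, `κ₁`, `ε` below is K-, L-, volume-free in that sense.

THE MATHEMATICS.  `A = Δ_{U₀} + a·T∘ι∘Q″` on `E = SiteL2K(F K c₀)`, `⟪v, A v′⟫ = ⟪Dv, Dv′⟫ + a⟪ιQ″v, ιQ″v′⟫` (§1).  For a positive fine weight `w = e^{φ}` (per-bond `|Δφ| ≤ θ`) and a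
coarse `w_c = e^{φ_c}` (`|φ − φ_c∘B| ≤ θ′`), the commutator of `A` with the multiplier `W = w·` is small IN THE ENERGY FORM with the weight carried on the right factor (§2):
`|re⟪z, W(Aλ) − A(Wλ)⟫| ≤ κ₁·X(z)·X(Wλ)`, `X(v) := ‖Dv‖ + √a‖ιQ″v‖ + ‖v‖`, `κ₁ = e₁ + e₁² + √a·C_T ρ′ + a·C_T²ρ′²`, `e₁ = √3η⁻¹(e^{θ}−1)`, `ρ′ = e^{θ′}−1` — from px5's two defect
identities (`D(w·λ) = w(b₋)·(Dλ + def_w λ)`, `Q″((g∘B)·λ) = g·Q″λ`) by moving every weight onto `Wλ` (`w(b₋)·def_w λ = −def_{w⁻¹}(Wλ)`).  §3: testing the error equation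
`A(ũ − G w₀) = −(W(Aλ) − A(Wλ))` (`ũ := Wλ`, `Aλ = W⁻¹w₀`) with the error and feeding px5's ✓`agmon_rows_exp` (`X(ũ) ≤ (8C_P + 8C_P²)‖w₀‖`) gives
★★★ `‖W·G(W⁻¹w₀) − G w₀‖ ≤ δ‖w₀‖`, `δ = C_P(2 + C_P)·κ₁·(8C_P + 8C_P²)` — K-, L-, volume-free.  (FILE B2b: `+` the adjoint-side row `‖WTW_c⁻¹ − T‖ ≤ C_Tρ′` and Parseval ⟹ the
`hplus`∕`hminus` of ✓`re_conj_gram_ge` ⟹ `‖M⁻¹ i i′‖ ≤ (m₀∕2 − 3ε²)⁻¹e^{−φ_c}` by ✓`gram_inv_entry_decay`.)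

WHAT IS PROVED (ns `Summit.QuantumFields.YangMills.Theorems.Prop7MassiveConjugateResolvent`).
* §1 `inner_massive_eq` (polarised energy), `inner_massive_inverse_symm` (`⟪l, G m⟫ = ⟪G l, m⟫`).
* §2 `DL2_weight_eq` (px5's gradient defect as an identity in `BondL2K`), `weight_gradDefect_eq_neg` (`w(b₋)·def_w λ = −def_{w⁻¹}(w·λ)`), `lift_topMean_weight_eq` (the mass side),
  `six_terms_le` (real bookkeeping), ★★ `abs_re_inner_weight_comm_le` (the form commutator bound; `maxHeartbeats 400000`, decl-local).
* (§3, the conjugated resolvent bound ★★★ `norm_weight_massive_inverse_sub_le`, is the sequel file `…MassiveConjugateResolventBound` — split for the 400-line rule.)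

References: S. Agmon (1982) Ch. 1 [folklore]; T. Bałaban, CMP **99** (1985) 389–434 [Balaban1985BackgroundPropagators] ((3.24) p.394, Thm 3.1 (3.46) p.398, (3.100)–(3.105) pp.413–414);
CMP **116** (1988) 1–22 [Balaban1988RG2Cluster] ((2.7) p.13).
-/

set_option autoImplicit false

noncomputable section

open scoped BigOperators Matrix.Norms.L2Operator InnerProductSpace ComplexConjugate

namespace Summit.QuantumFields.YangMills.Theorems.Prop7MassiveConjugateResolvent

open Literature.MathematicalPhysics.QuantumFieldTheory.Balaban1983to89
open Finset
open T4Continuum BlockAveraging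
open BlockAveraging (Idx)
open B7Prop1Explicit (U1 disp)
open B5Eq118OneStroke (iterBlockOf iterBlock)
open B10Eq27TorusAxialLog (holT transl)
open B7TransferAnalyticMean (meanCLM)
open B9Eq311L2Pairing (WL2)
open B11Eq103H1Complex (SiteL2K BondL2K)
open B9Eq39Adjoint (R)
open Summit.QuantumFields.YangMills.Theorems.Prop8Chart (emlIterU)
open Literature.MathematicalPhysics.QuantumFieldTheory.Balaban1983to89.T3ContinuumYM3Torus
open T3SectALandauChart (eta eta_pos bgUnits)
open T3PrintedRegularMinimiser (RegPr)
open T3PrintedRegularOrbits (sites_eq)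
open T3LevelShift (siteShift)
open Summit.QuantumFields.YangMills.Theorems.Prop7SectET3Transport (periodsT3)
open Summit.QuantumFields.YangMills.Theorems.Prop7SectET3HilbertLetters (W₂ toL2 toL2S DL2 DstarL2 covLapSite adjoint_DL2 inner_toL2)
open Summit.QuantumFields.YangMills.Theorems.Prop7SectET3RealCoordSums (inner_toL2S)
open Summit.QuantumFields.YangMills.Theorems.Prop7LaplaceAFlatLetters (norm_sq_toL2 norm_sq_toL2S)
open Summit.QuantumFields.YangMills.Theorems.Prop7MassivePropagatorAgmonLetters (topMean_blockConst_smul inner_toL2S_smul_left inner_toL2_smul_left norm_toL2S_smul_le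
  DL2_smul_eq_smul_add_defect normSq_gradDefect_le)
open Summit.QuantumFields.YangMills.Theorems.Prop7MassivePropagatorAgmon (agmon_rows_exp)
open Summit.QuantumFields.YangMills.Theorems.Prop7CovLapSiteEntryRows (inner_covLapSite_eq_inner_DL2)
open Literature.MathematicalPhysics.QuantumFieldTheory.Balaban1983to89.Beta.CombesThomasForm (abs_exp_sub_one_le)

variable (F : T3Family) {n K : ℕ} (h : n ≤ K) {c₀ c₁ : ℝ} [Fact (0 < c₀)] [Fact (0 < c₁)]
  {ε₀ : ℝ} (hε₀ : 0 < ε₀) (hε7 : 10 ^ 7 * (F.L : ℝ) ^ 3 * ε₀ ≤ 1)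
  (U₀ : GaugeField (F.P K) 0 (Matrix.specialUnitaryGroup (Fin 2) ℂ)) (hreg : RegPr F n K ε₀ U₀)
  (Q'' : SiteL2K ℂ 3 (periodsT3 F K) c₀ W₂ →ₗ[ℂ] (Site (F.P K) (K - n) → Matrix (Fin 2) (Fin 2) ℂ))
  (hseq : ∀ lam : Site (F.P K) 0 → Matrix (Fin 2) (Fin 2) ℂ, ∃ ns : (j : ℕ) → Site (F.P K) j → Matrix (Fin 2) (Fin 2) ℂ, ns 0 = lam ∧
      (∀ (j : ℕ) (y : Site (F.P K) (j + 1)), ns (j + 1) y = ns j (emb y) - meanCLM (Idx (F.P K)) (Matrix (Fin 2) (Fin 2) ℂ) fun i : Idx (F.P K) =>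
        ns j (emb y) - ((holT (emlIterU j (bgUnits F K U₀)) (emb y) (stairWord i.2.1 (off i.1)) : (Matrix (Fin 2) (Fin 2) ℂ)ˣ) : Matrix (Fin 2) (Fin 2) ℂ) *
          ns j (transl (emb y) (disp (stairWord i.2.1 (off i.1)))) * (((holT (emlIterU j (bgUnits F K U₀)) (emb y) (stairWord i.2.1 (off i.1)))⁻¹ : (Matrix (Fin 2) (Fin 2) ℂ)ˣ) : Matrix (Fin 2) (Fin 2) ℂ)) ∧
      ns (K - n) = Q'' (toL2S F K c₀ lam))
  (ι : (Site (F.P K) (K - n) → Matrix (Fin 2) (Fin 2) ℂ) →ₗ[ℂ] SiteL2K ℂ 3 (periodsT3 F n) c₁ W₂)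
  (hι : ∀ c, ι c = toL2S F n c₁ (fun z => c (siteShift (sites_eq F n K h) z)))
  (T : SiteL2K ℂ 3 (periodsT3 F n) c₁ W₂ →ₗ[ℂ] SiteL2K ℂ 3 (periodsT3 F K) c₀ W₂)
  (hT : ∀ (l : SiteL2K ℂ 3 (periodsT3 F K) c₀ W₂) (f : SiteL2K ℂ 3 (periodsT3 F n) c₁ W₂), ⟪ι (Q'' l), f⟫_ℂ = ⟪l, T f⟫_ℂ)
  {a : ℝ} (ha : 0 < a)
  (G : SiteL2K ℂ 3 (periodsT3 F K) c₀ W₂ →ₗ[ℂ] SiteL2K ℂ 3 (periodsT3 F K) c₀ W₂)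
  (hAG : ∀ f, covLapSite F n K c₀ U₀ (G f) + (a : ℂ) • T (ι (Q'' (G f))) = f)
  (hGA : ∀ u, G (covLapSite F n K c₀ U₀ u + (a : ℂ) • T (ι (Q'' u))) = u)

/-! ## §1 The polarised energy of the massive operator; symmetry of its inverse -/

include hT in
/-- **POLARISED ENERGY**: `⟪v, Δ_{U₀}v′ + a·T(ι(Q″v′))⟫ = ⟪D_{U₀}v, D_{U₀}v′⟫ + a·⟪ι(Q″v), ι(Q″v′)⟫` (px17 ✓`inner_covLapSite_eq_inner_DL2` + `hT`). [cite: Balaban1985BackgroundPropagators, (3.24) p.394] -/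
theorem inner_massive_eq (v v' : SiteL2K ℂ 3 (periodsT3 F K) c₀ W₂) :
    ⟪v, covLapSite F n K c₀ U₀ v' + (a : ℂ) • T (ι (Q'' v'))⟫_ℂ = ⟪DL2 F n K c₀ U₀ v, DL2 F n K c₀ U₀ v'⟫_ℂ + (a : ℂ) * ⟪ι (Q'' v), ι (Q'' v')⟫_ℂ := by
  rw [inner_add_right, inner_smul_right, inner_covLapSite_eq_inner_DL2, ← hT]

include hT hAG in
/-- **THE MASSIVE INVERSE IS SYMMETRIC**: `⟪l, G m⟫ = ⟪G l, m⟫` (`A` is symmetric and `G` its two-sided inverse). [cite: Balaban1985BackgroundPropagators, (3.24)–(3.25) p.394] -/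
theorem inner_massive_inverse_symm (l m : SiteL2K ℂ 3 (periodsT3 F K) c₀ W₂) : ⟪l, G m⟫_ℂ = ⟪G l, m⟫_ℂ := by
  have h1 : ⟪l, G m⟫_ℂ = ⟪covLapSite F n K c₀ U₀ (G l) + (a : ℂ) • T (ι (Q'' (G l))), G m⟫_ℂ := by rw [hAG]
  have h2 : ⟪G l, m⟫_ℂ = ⟪G l, covLapSite F n K c₀ U₀ (G m) + (a : ℂ) • T (ι (Q'' (G m)))⟫_ℂ := by rw [hAG]
  have h3 : ⟪covLapSite F n K c₀ U₀ (G l) + (a : ℂ) • T (ι (Q'' (G l))), G m⟫_ℂ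
      = (starRingEnd ℂ) ⟪G m, covLapSite F n K c₀ U₀ (G l) + (a : ℂ) • T (ι (Q'' (G l)))⟫_ℂ := (inner_conj_symm _ _).symm
  rw [h1, h3, inner_massive_eq F U₀ Q'' ι T hT (G m) (G l), h2, inner_massive_eq F U₀ Q'' ι T hT (G l) (G m), map_add, map_mul, inner_conj_symm, inner_conj_symm,
    Complex.conj_ofReal]

/-! ## §2 The commutator of the massive operator with an exponential weight, in the energy form -/

section Commutator

/-- **THE GRADIENT OF A WEIGHTED FIELD** (px5 ✓`DL2_smul_eq_smul_add_defect` as an identity in `BondL2K`): for a nowhere-zero site weight `w`,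
`D_{U₀}(toL2S(w·λ)) = toL2(b ↦ w(b₋)·((D_{U₀}λ)(b) + def_w λ(b)))`, `def_w λ(b) = η⁻¹(w(b₊)∕w(b₋) − 1)·Ad(U₀(b))λ(b₊)`. [cite: Balaban1985BackgroundPropagators, (3.3) p.391, Thm 3.1 p.397] -/
theorem DL2_weight_eq (w : Site (F.P K) 0 → ℝ) (hw : ∀ x, w x ≠ 0) (lam : Site (F.P K) 0 → Matrix (Fin 2) (Fin 2) ℂ) :
    DL2 F n K c₀ U₀ (toL2S F K c₀ (fun x => w x • lam x))
      = toL2 F K c₀ (fun b => w b.src • ((toL2 F K c₀).symm (DL2 F n K c₀ U₀ (toL2S F K c₀ lam)) b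
          + ((eta F n K)⁻¹ * (w b.tgt / w b.src - 1)) • R (bgUnits F K U₀ b) (lam b.tgt))) := by
  apply (toL2 F K c₀).symm.injective
  rw [LinearEquiv.symm_apply_apply]
  funext b
  exact DL2_smul_eq_smul_add_defect F U₀ w lam b (hw b.src)

omit [Fact (0 < c₀)] in
/-- **MOVING THE WEIGHT ONTO THE DEFECT**: `w(b₋)·def_w λ(b) = −def_{w⁻¹}(w·λ)(b)` pointwise (`w(b₋)(w(b₊)∕w(b₋) − 1) = −(w(b₋)∕w(b₊) − 1)·w(b₊)`).
[cite: Balaban1985BackgroundPropagators, Thm 3.1 p.397] -/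
theorem weight_gradDefect_eq_neg (w : Site (F.P K) 0 → ℝ) (hw : ∀ x, w x ≠ 0) (lam : Site (F.P K) 0 → Matrix (Fin 2) (Fin 2) ℂ) (b : PBond (F.P K) 0) :
    w b.src • (((eta F n K)⁻¹ * (w b.tgt / w b.src - 1)) • R (bgUnits F K U₀ b) (lam b.tgt))
      = -((((eta F n K)⁻¹ * ((w b.tgt)⁻¹ / (w b.src)⁻¹ - 1)) • R (bgUnits F K U₀ b) (w b.tgt • lam b.tgt))) := by
  have hs : w b.src * ((eta F n K)⁻¹ * (w b.tgt / w b.src - 1)) = -((eta F n K)⁻¹ * ((w b.tgt)⁻¹ / (w b.src)⁻¹ - 1) * w b.tgt) := by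
    have hs' := hw b.src; have ht := hw b.tgt; field_simp; ring
  rw [B9Eq39Adjoint.R_smul, smul_smul, smul_smul, hs, neg_smul]

include hseq hι in
omit [Fact (0 < c₀)] [Fact (0 < c₁)] in
/-- **THE TOP MEAN OF A WEIGHTED FIELD THROUGH THE COARSE WEIGHT**: `ι(Q″(toL2S(w·λ))) = toL2S_n((w_c∘σ)·(Q″(toL2S(((w_c∘B)⁻¹w)·λ)))∘σ)` — i.e. the fine weight is the coarse weight
times the in-block ratio `r₊ = (w_c∘B)⁻¹·w` (px5 ✓`topMean_blockConst_smul`). [cite: Balaban1985BackgroundPropagators, (3.19) p.393, (3.24) p.394] -/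
theorem lift_topMean_weight_eq (w : Site (F.P K) 0 → ℝ) (wc : Site (F.P K) (K - n) → ℝ) (hwc : ∀ y, wc y ≠ 0) (lam : Site (F.P K) 0 → Matrix (Fin 2) (Fin 2) ℂ) :
    ι (Q'' (toL2S F K c₀ (fun x => w x • lam x)))
      = toL2S F n c₁ (fun z => wc (siteShift (sites_eq F n K h) z) •
          Q'' (toL2S F K c₀ (fun x => ((wc (iterBlockOf (K - n) x))⁻¹ * w x) • lam x)) (siteShift (sites_eq F n K h) z)) := by
  rw [hι]
  congr 1
  funext z
  have hb := topMean_blockConst_smul F U₀ Q'' hseq wc (fun x => ((wc (iterBlockOf (K - n) x))⁻¹ * w x) • lam x) (siteShift (sites_eq F n K h) z)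
  have hfun : (fun x => wc (iterBlockOf (K - n) x) • (((wc (iterBlockOf (K - n) x))⁻¹ * w x) • lam x)) = fun x => w x • lam x := by
    funext x; rw [smul_smul, ← mul_assoc, mul_inv_cancel₀ (hwc _), one_mul]
  rw [← hb, hfun]

omit [Fact (0 < c₀)] [Fact (0 < c₁)] in
/-- Real bookkeeping for the form commutator bound: the six products are dominated by `κ₁·X(z)·X(ũ)`. [folklore] -/
theorem six_terms_le {a sa e₁ CT ρ' Zn ZD ZQ Un UD UQ : ℝ} (hsa : 0 ≤ sa) (hsa2 : sa * sa = a) (he₁ : 0 ≤ e₁) (hCT : 0 ≤ CT) (hρ' : 0 ≤ ρ')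
    (hZn : 0 ≤ Zn) (hZD : 0 ≤ ZD) (hZQ : 0 ≤ ZQ) (hUn : 0 ≤ Un) (hUD : 0 ≤ UD) (hUQ : 0 ≤ UQ) :
    (e₁ * Zn * (UD + e₁ * Un) + ZD * (e₁ * Un)) + a * (ZQ * (CT * ρ' * Un) + (CT * ρ' * Zn) * UQ + (CT * ρ' * Zn) * (CT * ρ' * Un))
      ≤ (e₁ + e₁ ^ 2 + sa * CT * ρ' + a * CT ^ 2 * ρ' ^ 2) * (ZD + sa * ZQ + Zn) * (UD + sa * UQ + Un) := by
  have hexp : (ZD + sa * ZQ + Zn) * (UD + sa * UQ + Un) = ZD * UD + ZD * (sa * UQ) + ZD * Un + (sa * ZQ) * UD + (sa * ZQ) * (sa * UQ)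
      + (sa * ZQ) * Un + Zn * UD + Zn * (sa * UQ) + Zn * Un := by ring
  have n1 := mul_nonneg hZD hUD
  have n2 := mul_nonneg hZD (mul_nonneg hsa hUQ)
  have n3 := mul_nonneg hZD hUn
  have n4 := mul_nonneg (mul_nonneg hsa hZQ) hUD
  have n5 := mul_nonneg (mul_nonneg hsa hZQ) (mul_nonneg hsa hUQ)
  have n6 := mul_nonneg (mul_nonneg hsa hZQ) hUn
  have n7 := mul_nonneg hZn hUD
  have n8 := mul_nonneg hZn (mul_nonneg hsa hUQ)
  have n9 := mul_nonneg hZn hUn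
  have hXX1 : Zn * UD + ZD * Un ≤ (ZD + sa * ZQ + Zn) * (UD + sa * UQ + Un) := by rw [hexp]; linarith
  have hXX2 : Zn * Un ≤ (ZD + sa * ZQ + Zn) * (UD + sa * UQ + Un) := by rw [hexp]; linarith
  have hXX3 : (sa * ZQ) * Un + Zn * (sa * UQ) ≤ (ZD + sa * ZQ + Zn) * (UD + sa * UQ + Un) := by rw [hexp]; linarith
  have hregroup : (e₁ * Zn * (UD + e₁ * Un) + ZD * (e₁ * Un)) + a * (ZQ * (CT * ρ' * Un) + (CT * ρ' * Zn) * UQ + (CT * ρ' * Zn) * (CT * ρ' * Un))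
      = e₁ * (Zn * UD + ZD * Un) + e₁ ^ 2 * (Zn * Un) + (sa * CT * ρ') * ((sa * ZQ) * Un + Zn * (sa * UQ)) + (a * CT ^ 2 * ρ' ^ 2) * (Zn * Un) := by
    rw [← hsa2]; ring
  rw [hregroup]
  have hc3 : 0 ≤ sa * CT * ρ' := by positivity
  have hc4 : 0 ≤ a * CT ^ 2 * ρ' ^ 2 := by rw [← hsa2]; positivity
  calc e₁ * (Zn * UD + ZD * Un) + e₁ ^ 2 * (Zn * Un) + (sa * CT * ρ') * ((sa * ZQ) * Un + Zn * (sa * UQ)) + (a * CT ^ 2 * ρ' ^ 2) * (Zn * Un)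
      ≤ e₁ * ((ZD + sa * ZQ + Zn) * (UD + sa * UQ + Un)) + e₁ ^ 2 * ((ZD + sa * ZQ + Zn) * (UD + sa * UQ + Un))
          + (sa * CT * ρ') * ((ZD + sa * ZQ + Zn) * (UD + sa * UQ + Un)) + (a * CT ^ 2 * ρ' ^ 2) * ((ZD + sa * ZQ + Zn) * (UD + sa * UQ + Un)) :=
        add_le_add (add_le_add (add_le_add (mul_le_mul_of_nonneg_left hXX1 he₁) (mul_le_mul_of_nonneg_left hXX2 (by positivity)))
          (mul_le_mul_of_nonneg_left hXX3 hc3)) (mul_le_mul_of_nonneg_left hXX2 hc4)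
    _ = (e₁ + e₁ ^ 2 + sa * CT * ρ' + a * CT ^ 2 * ρ' ^ 2) * (ZD + sa * ZQ + Zn) * (UD + sa * UQ + Un) := by ring

include hseq hι hT ha in
set_option maxHeartbeats 400000 in
/-- ★★ **THE FORM COMMUTATOR BOUND** `|re⟪z, W(Aλ) − A(Wλ)⟫| ≤ κ₁·X(z)·X(Wλ)`.  DATA: site weight `w > 0` with inverse `wi` (`wi·w = 1`) and bond-ratio bounds `|w(b₊)∕w(b₋) − 1|,
|wi(b₊)∕wi(b₋) − 1| ≤ ρ`; coarse weight `wc > 0` with `|wc(B x)⁻¹w(x) − 1|, |wc(B x)wi(x) − 1| ≤ ρ′`; `‖ι(Q″v)‖ ≤ C_T‖v‖`.  With `e₁ := √3·η⁻¹ρ`, `X(v) := ‖D_{U₀}v‖ + √a‖ι(Q″v)‖ + ‖v‖`: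
`|re⟪toL2S z, toL2S(w·(Aλ)) − A(toL2S(w·λ))⟫| ≤ (e₁ + e₁² + √a·C_Tρ′ + a·C_T²ρ′²)·X(toL2S z)·X(toL2S(w·λ))`.  (Every weight is moved onto `w·λ`; no unweighted `λ` survives.)
[cite: Balaban1985BackgroundPropagators, Thm 3.1 (3.46) p.398, (3.100)–(3.105) pp.413–414] -/
theorem abs_re_inner_weight_comm_le (w wi : Site (F.P K) 0 → ℝ) (hw : ∀ x, 0 < w x) (hwi : ∀ x, wi x * w x = 1)
    {ρ : ℝ} (hρ : 0 ≤ ρ) (hwρ : ∀ b : PBond (F.P K) 0, |w b.tgt / w b.src - 1| ≤ ρ) (hwiρ : ∀ b : PBond (F.P K) 0, |wi b.tgt / wi b.src - 1| ≤ ρ)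
    (wc : Site (F.P K) (K - n) → ℝ) (hwc : ∀ y, 0 < wc y) {ρ' : ℝ} (hρ' : 0 ≤ ρ')
    (hr : ∀ x, |(wc (iterBlockOf (K - n) x))⁻¹ * w x - 1| ≤ ρ') (hr' : ∀ x, |wc (iterBlockOf (K - n) x) * wi x - 1| ≤ ρ')
    {CT : ℝ} (hCT : 0 ≤ CT) (hCTb : ∀ v : Site (F.P K) 0 → Matrix (Fin 2) (Fin 2) ℂ, ‖ι (Q'' (toL2S F K c₀ v))‖ ≤ CT * ‖toL2S F K c₀ v‖)
    (z lam : Site (F.P K) 0 → Matrix (Fin 2) (Fin 2) ℂ) :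
    |RCLike.re ⟪toL2S F K c₀ z,
        toL2S F K c₀ (fun x => w x • (toL2S F K c₀).symm (covLapSite F n K c₀ U₀ (toL2S F K c₀ lam) + (a : ℂ) • T (ι (Q'' (toL2S F K c₀ lam)))) x)
          - (covLapSite F n K c₀ U₀ (toL2S F K c₀ (fun x => w x • lam x)) + (a : ℂ) • T (ι (Q'' (toL2S F K c₀ (fun x => w x • lam x)))))⟫_ℂ|
      ≤ (Real.sqrt 3 * (eta F n K)⁻¹ * ρ + (Real.sqrt 3 * (eta F n K)⁻¹ * ρ) ^ 2 + Real.sqrt a * CT * ρ' + a * CT ^ 2 * ρ' ^ 2)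
        * (‖DL2 F n K c₀ U₀ (toL2S F K c₀ z)‖ + Real.sqrt a * ‖ι (Q'' (toL2S F K c₀ z))‖ + ‖toL2S F K c₀ z‖)
        * (‖DL2 F n K c₀ U₀ (toL2S F K c₀ (fun x => w x • lam x))‖ + Real.sqrt a * ‖ι (Q'' (toL2S F K c₀ (fun x => w x • lam x)))‖
            + ‖toL2S F K c₀ (fun x => w x • lam x)‖) := by
  have hη : 0 < eta F n K := eta_pos F n K
  have hw0 : ∀ x, w x ≠ 0 := fun x => (hw x).ne'
  have hwi0 : ∀ x, wi x ≠ 0 := fun x h0 => by have := hwi x; rw [h0, zero_mul] at this; exact zero_ne_one this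
  have hwc0 : ∀ y, wc y ≠ 0 := fun y => (hwc y).ne'
  have hwiw : ∀ x, wi x = (w x)⁻¹ := fun x => (inv_eq_of_mul_eq_one_left (hwi x)).symm
  -- names
  set zt := toL2S F K c₀ z with hzt
  set ut := toL2S F K c₀ (fun x => w x • lam x) with hut
  set lt := toL2S F K c₀ lam with hlt
  set e₁ : ℝ := Real.sqrt 3 * (eta F n K)⁻¹ * ρ with he₁
  have he₁0 : 0 ≤ e₁ := by positivity
  -- the weighted operator value, unfolded
  have hAl : toL2S F K c₀ (fun x => w x • (toL2S F K c₀).symm (covLapSite F n K c₀ U₀ lt + (a : ℂ) • T (ι (Q'' lt))) x)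
      = toL2S F K c₀ (fun x => w x • (toL2S F K c₀).symm (covLapSite F n K c₀ U₀ lt + (a : ℂ) • T (ι (Q'' lt))) x) := rfl
  -- STEP 1: `⟪z, W(Aλ)⟫ = ⟪W z, Aλ⟫ = energy form`
  have h1 : ⟪zt, toL2S F K c₀ (fun x => w x • (toL2S F K c₀).symm (covLapSite F n K c₀ U₀ lt + (a : ℂ) • T (ι (Q'' lt))) x)⟫_ℂ
      = ⟪DL2 F n K c₀ U₀ (toL2S F K c₀ (fun x => w x • z x)), DL2 F n K c₀ U₀ lt⟫_ℂ
          + (a : ℂ) * ⟪ι (Q'' (toL2S F K c₀ (fun x => w x • z x))), ι (Q'' lt)⟫_ℂ := by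
    rw [hzt, ← inner_toL2S_smul_left, LinearEquiv.apply_symm_apply, inner_massive_eq F U₀ Q'' ι T hT]
  -- STEP 2: `⟪z, A(Wλ)⟫ = energy form`
  have h2 : ⟪zt, covLapSite F n K c₀ U₀ ut + (a : ℂ) • T (ι (Q'' ut))⟫_ℂ = ⟪DL2 F n K c₀ U₀ zt, DL2 F n K c₀ U₀ ut⟫_ℂ + (a : ℂ) * ⟪ι (Q'' zt), ι (Q'' ut)⟫_ℂ :=
    inner_massive_eq F U₀ Q'' ι T hT zt ut
  -- GRADIENT SIDE.  The two weighted gradients.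
  set Dz : PBond (F.P K) 0 → Matrix (Fin 2) (Fin 2) ℂ := (toL2 F K c₀).symm (DL2 F n K c₀ U₀ zt) with hDz
  set Dl : PBond (F.P K) 0 → Matrix (Fin 2) (Fin 2) ℂ := (toL2 F K c₀).symm (DL2 F n K c₀ U₀ lt) with hDl
  set dz : PBond (F.P K) 0 → Matrix (Fin 2) (Fin 2) ℂ := fun b => ((eta F n K)⁻¹ * (w b.tgt / w b.src - 1)) • R (bgUnits F K U₀ b) (z b.tgt) with hdz
  set dl : PBond (F.P K) 0 → Matrix (Fin 2) (Fin 2) ℂ := fun b => ((eta F n K)⁻¹ * (w b.tgt / w b.src - 1)) • R (bgUnits F K U₀ b) (lam b.tgt) with hdl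
  set du : PBond (F.P K) 0 → Matrix (Fin 2) (Fin 2) ℂ := fun b => ((eta F n K)⁻¹ * (wi b.tgt / wi b.src - 1)) • R (bgUnits F K U₀ b) (w b.tgt • lam b.tgt) with hdu
  have hDwz : DL2 F n K c₀ U₀ (toL2S F K c₀ (fun x => w x • z x)) = toL2 F K c₀ (fun b => w b.src • (Dz b + dz b)) := by
    rw [hDz, hzt]; exact DL2_weight_eq F U₀ w hw0 z
  have hDwl : DL2 F n K c₀ U₀ ut = toL2 F K c₀ (fun b => w b.src • (Dl b + dl b)) := by
    rw [hut, hDl, hlt]; exact DL2_weight_eq F U₀ w hw0 lam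
  -- `w(b₋)·dl = −du`
  have hwdl : (fun b => w b.src • dl b) = fun b => -du b := by
    funext b
    rw [hdl, hdu]
    simp only
    rw [weight_gradDefect_eq_neg F U₀ w hw0 lam b, hwiw, hwiw]
  -- hence `toL2(w(b₋)·Dl) = Dũ + toL2 du`
  have hwDl : toL2 F K c₀ (fun b => w b.src • Dl b) = DL2 F n K c₀ U₀ ut + toL2 F K c₀ du := by
    have hsplit : (fun b => w b.src • (Dl b + dl b)) = (fun b => w b.src • Dl b) + fun b => w b.src • dl b := by
      funext b; simp only [Pi.add_apply, smul_add]
    rw [hDwl, hsplit, map_add, hwdl]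
    have : toL2 F K c₀ (fun b => -du b) = -toL2 F K c₀ du := by rw [← map_neg]; rfl
    rw [this, neg_add_cancel_right]
  -- the gradient difference `G₁ = ⟪toL2 dz, Dũ + toL2 du⟫ + ⟪D z, toL2 du⟫`
  have hG1 : ⟪DL2 F n K c₀ U₀ (toL2S F K c₀ (fun x => w x • z x)), DL2 F n K c₀ U₀ lt⟫_ℂ - ⟪DL2 F n K c₀ U₀ zt, DL2 F n K c₀ U₀ ut⟫_ℂ
      = ⟪toL2 F K c₀ dz, DL2 F n K c₀ U₀ ut + toL2 F K c₀ du⟫_ℂ + ⟪DL2 F n K c₀ U₀ zt, toL2 F K c₀ du⟫_ℂ := by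
    have hl : DL2 F n K c₀ U₀ lt = toL2 F K c₀ Dl := by rw [hDl, LinearEquiv.apply_symm_apply]
    have hz' : DL2 F n K c₀ U₀ zt = toL2 F K c₀ Dz := by rw [hDz, LinearEquiv.apply_symm_apply]
    have hsplit : (fun b => w b.src • (Dz b + dz b)) = fun b => w b.src • (Dz + dz) b := by funext b; rfl
    rw [hDwz, hsplit, hl, inner_toL2_smul_left, hwDl, map_add, inner_add_left, hDwl]
    have hsplit2 : (fun b => w b.src • (Dl b + dl b)) = (fun b => w b.src • Dl b) + fun b => w b.src • dl b := by
      funext b; simp only [Pi.add_apply, smul_add]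
    rw [hsplit2, map_add, hwDl, hwdl, hz']
    have : toL2 F K c₀ (fun b => -du b) = -toL2 F K c₀ du := by rw [← map_neg]; rfl
    rw [this, inner_add_right, inner_add_right, inner_neg_right]
    ring
  -- MASS SIDE.  `ιQ″(w·z) = toL2S_n(wc∘σ · q₁∘σ)`, `q₁ = Q″(r₊·z)`; `wc·Q″λ = Q″((wc∘B·wi)·ũ)`.
  set r : Site (F.P K) 0 → ℝ := fun x => (wc (iterBlockOf (K - n) x))⁻¹ * w x - 1 with hr_def
  set r' : Site (F.P K) 0 → ℝ := fun x => wc (iterBlockOf (K - n) x) * wi x - 1 with hr'_def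
  have hM1 : ⟪ι (Q'' (toL2S F K c₀ (fun x => w x • z x))), ι (Q'' lt)⟫_ℂ
      = ⟪ι (Q'' (toL2S F K c₀ (fun x => ((wc (iterBlockOf (K - n) x))⁻¹ * w x) • z x))), ι (Q'' (toL2S F K c₀ (fun x => (wc (iterBlockOf (K - n) x) * wi x) • (w x • lam x))))⟫_ℂ := by
    have hsecond : toL2S F n c₁ (fun zz => wc (siteShift (sites_eq F n K h) zz) • Q'' lt (siteShift (sites_eq F n K h) zz))
        = ι (Q'' (toL2S F K c₀ (fun x => (wc (iterBlockOf (K - n) x) * wi x) • (w x • lam x)))) := by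
      have hfun : (fun x => (wc (iterBlockOf (K - n) x) * wi x) • (w x • lam x)) = fun x => wc (iterBlockOf (K - n) x) • lam x := by
        funext x; rw [smul_smul, mul_assoc, hwi x, mul_one]
      rw [hfun, hι]
      congr 1
      funext zz
      rw [hlt]
      exact (topMean_blockConst_smul F U₀ Q'' hseq wc lam (siteShift (sites_eq F n K h) zz)).symm
    rw [lift_topMean_weight_eq F h U₀ Q'' hseq ι hι w wc hwc0 z, ← hsecond, hι, hι]
    exact inner_toL2S_smul_left (F := F) (fun zz => wc (siteShift (sites_eq F n K h) zz)) _ _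
  -- splitting the in-block ratios: `r₊ = 1 + r`, `r₊′ = 1 + r′`
  have hzplus : toL2S F K c₀ (fun x => ((wc (iterBlockOf (K - n) x))⁻¹ * w x) • z x) = zt + toL2S F K c₀ (fun x => r x • z x) := by
    rw [hzt, ← map_add]; congr 1; funext x
    simp only [hr_def, Pi.add_apply, sub_smul, one_smul, add_sub_cancel]
  have huplus : toL2S F K c₀ (fun x => (wc (iterBlockOf (K - n) x) * wi x) • (w x • lam x)) = ut + toL2S F K c₀ (fun x => r' x • (w x • lam x)) := by
    rw [hut, ← map_add]; congr 1; funext x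
    simp only [hr'_def, Pi.add_apply, sub_smul, one_smul, add_sub_cancel]
  set qz := ι (Q'' (toL2S F K c₀ (fun x => r x • z x))) with hqz
  set qu := ι (Q'' (toL2S F K c₀ (fun x => r' x • (w x • lam x)))) with hqu
  -- the commutator in the energy form
  have hdiff : ⟪zt, toL2S F K c₀ (fun x => w x • (toL2S F K c₀).symm (covLapSite F n K c₀ U₀ lt + (a : ℂ) • T (ι (Q'' lt))) x)⟫_ℂ
        - ⟪zt, covLapSite F n K c₀ U₀ ut + (a : ℂ) • T (ι (Q'' ut))⟫_ℂ
      = (⟪toL2 F K c₀ dz, DL2 F n K c₀ U₀ ut + toL2 F K c₀ du⟫_ℂ + ⟪DL2 F n K c₀ U₀ zt, toL2 F K c₀ du⟫_ℂ)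
        + (a : ℂ) * (⟪ι (Q'' zt), qu⟫_ℂ + ⟪qz, ι (Q'' ut)⟫_ℂ + ⟪qz, qu⟫_ℂ) := by
    rw [h1, h2, hM1, hzplus, huplus, map_add, map_add, map_add, map_add, inner_add_left, inner_add_right, inner_add_right, ← hqz, ← hqu, ← hG1]
    ring
  -- SIZES.  Gradient defects.
  have hdz_le : ‖toL2 F K c₀ dz‖ ≤ e₁ * ‖zt‖ := by
    have hsq := normSq_gradDefect_le F (n := n) U₀ (c₀ := c₀) w hwρ z
    have h0 : 0 ≤ e₁ * ‖zt‖ := by positivity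
    refine (pow_le_pow_iff_left₀ (norm_nonneg _) h0 two_ne_zero).1 ?_
    calc ‖toL2 F K c₀ dz‖ ^ 2 ≤ 3 * ((eta F n K)⁻¹) ^ 2 * ρ ^ 2 * ‖toL2S F K c₀ z‖ ^ 2 := hsq
      _ = (e₁ * ‖zt‖) ^ 2 := by rw [he₁, hzt, mul_pow, mul_pow, mul_pow, Real.sq_sqrt (by norm_num : (0:ℝ) ≤ 3)]
  have hdu_le : ‖toL2 F K c₀ du‖ ≤ e₁ * ‖ut‖ := by
    have hsq := normSq_gradDefect_le F (n := n) U₀ (c₀ := c₀) wi hwiρ (fun x => w x • lam x)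
    have h0 : 0 ≤ e₁ * ‖ut‖ := by positivity
    refine (pow_le_pow_iff_left₀ (norm_nonneg _) h0 two_ne_zero).1 ?_
    calc ‖toL2 F K c₀ du‖ ^ 2 ≤ 3 * ((eta F n K)⁻¹) ^ 2 * ρ ^ 2 * ‖toL2S F K c₀ (fun x => w x • lam x)‖ ^ 2 := hsq
      _ = (e₁ * ‖ut‖) ^ 2 := by rw [he₁, hut, mul_pow, mul_pow, mul_pow, Real.sq_sqrt (by norm_num : (0:ℝ) ≤ 3)]
  -- mass defects
  have hqz_le : ‖qz‖ ≤ CT * ρ' * ‖zt‖ := by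
    calc ‖qz‖ ≤ CT * ‖toL2S F K c₀ (fun x => r x • z x)‖ := hCTb _
      _ ≤ CT * (ρ' * ‖toL2S F K c₀ z‖) := mul_le_mul_of_nonneg_left (norm_toL2S_smul_le F r hρ' (fun x => hr x) z) hCT
      _ = CT * ρ' * ‖zt‖ := by rw [hzt]; ring
  have hqu_le : ‖qu‖ ≤ CT * ρ' * ‖ut‖ := by
    calc ‖qu‖ ≤ CT * ‖toL2S F K c₀ (fun x => r' x • (w x • lam x))‖ := hCTb _
      _ ≤ CT * (ρ' * ‖toL2S F K c₀ (fun x => w x • lam x)‖) := mul_le_mul_of_nonneg_left (norm_toL2S_smul_le F r' hρ' (fun x => hr' x) _) hCT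
      _ = CT * ρ' * ‖ut‖ := by rw [hut]; ring
  -- the six norms
  have hZn0 : 0 ≤ ‖zt‖ := norm_nonneg _
  have hZD0 : 0 ≤ ‖DL2 F n K c₀ U₀ zt‖ := norm_nonneg _
  have hZQ0 : 0 ≤ ‖ι (Q'' zt)‖ := norm_nonneg _
  have hUn0 : 0 ≤ ‖ut‖ := norm_nonneg _
  have hUD0 : 0 ≤ ‖DL2 F n K c₀ U₀ ut‖ := norm_nonneg _
  have hUQ0 : 0 ≤ ‖ι (Q'' ut)‖ := norm_nonneg _
  have hsa : 0 ≤ Real.sqrt a := Real.sqrt_nonneg _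
  have hsa2 : Real.sqrt a * Real.sqrt a = a := Real.mul_self_sqrt ha.le
  -- the six pieces
  have p1 : ‖⟪toL2 F K c₀ dz, DL2 F n K c₀ U₀ ut + toL2 F K c₀ du⟫_ℂ‖ ≤ e₁ * ‖zt‖ * (‖DL2 F n K c₀ U₀ ut‖ + e₁ * ‖ut‖) := by
    calc ‖⟪toL2 F K c₀ dz, DL2 F n K c₀ U₀ ut + toL2 F K c₀ du⟫_ℂ‖ ≤ ‖toL2 F K c₀ dz‖ * ‖DL2 F n K c₀ U₀ ut + toL2 F K c₀ du‖ := norm_inner_le_norm _ _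
      _ ≤ (e₁ * ‖zt‖) * (‖DL2 F n K c₀ U₀ ut‖ + e₁ * ‖ut‖) := mul_le_mul hdz_le ((norm_add_le _ _).trans (add_le_add le_rfl hdu_le)) (norm_nonneg _) (by positivity)
      _ = _ := by ring
  have p2 : ‖⟪DL2 F n K c₀ U₀ zt, toL2 F K c₀ du⟫_ℂ‖ ≤ ‖DL2 F n K c₀ U₀ zt‖ * (e₁ * ‖ut‖) :=
    (norm_inner_le_norm _ _).trans (mul_le_mul_of_nonneg_left hdu_le hZD0)
  have p3 : ‖⟪ι (Q'' zt), qu⟫_ℂ‖ ≤ ‖ι (Q'' zt)‖ * (CT * ρ' * ‖ut‖) := (norm_inner_le_norm _ _).trans (mul_le_mul_of_nonneg_left hqu_le hZQ0)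
  have p4 : ‖⟪qz, ι (Q'' ut)⟫_ℂ‖ ≤ (CT * ρ' * ‖zt‖) * ‖ι (Q'' ut)‖ := (norm_inner_le_norm _ _).trans (mul_le_mul_of_nonneg_right hqz_le hUQ0)
  have p5 : ‖⟪qz, qu⟫_ℂ‖ ≤ (CT * ρ' * ‖zt‖) * (CT * ρ' * ‖ut‖) :=
    (norm_inner_le_norm _ _).trans (mul_le_mul hqz_le hqu_le (norm_nonneg _) (by positivity))
  -- assemble
  rw [← inner_sub_right] at hdiff
  rw [hdiff]
  refine (RCLike.abs_re_le_norm _).trans ?_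
  have hna : ‖(a : ℂ)‖ = a := by rw [Complex.norm_real, Real.norm_of_nonneg ha.le]
  have hsum : ‖(⟪toL2 F K c₀ dz, DL2 F n K c₀ U₀ ut + toL2 F K c₀ du⟫_ℂ + ⟪DL2 F n K c₀ U₀ zt, toL2 F K c₀ du⟫_ℂ)
          + (a : ℂ) * (⟪ι (Q'' zt), qu⟫_ℂ + ⟪qz, ι (Q'' ut)⟫_ℂ + ⟪qz, qu⟫_ℂ)‖
      ≤ (e₁ * ‖zt‖ * (‖DL2 F n K c₀ U₀ ut‖ + e₁ * ‖ut‖) + ‖DL2 F n K c₀ U₀ zt‖ * (e₁ * ‖ut‖))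
          + a * (‖ι (Q'' zt)‖ * (CT * ρ' * ‖ut‖) + (CT * ρ' * ‖zt‖) * ‖ι (Q'' ut)‖ + (CT * ρ' * ‖zt‖) * (CT * ρ' * ‖ut‖)) := by
    refine (norm_add_le _ _).trans (add_le_add ((norm_add_le _ _).trans (add_le_add p1 p2)) ?_)
    rw [norm_mul, hna]
    exact mul_le_mul_of_nonneg_left ((norm_add_le _ _).trans (add_le_add ((norm_add_le _ _).trans (add_le_add p3 p4)) p5)) ha.le
  exact hsum.trans (six_terms_le hsa hsa2 he₁0 hCT hρ' hZn0 hZD0 hZQ0 hUn0 hUD0 hUQ0)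

end Commutator

end Summit.QuantumFields.YangMills.Theorems.Prop7MassiveConjugateResolvent

end
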